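/-
Copyright: the b2b-balaban T⁴-continuum CRUX team, row NE7b OWNER lineage `t4-ne7b-p1` (gen 119). Project licence.
-/
import Mathlib.Algebra.Order.Chebyshev
import Summits.QuantumFields.BalabanUV.T4Continuum.Spine.NE7b.SupConvexStepIntegrated
import Summits.QuantumFields.BalabanUV.T4Continuum.Spine.NE7b.SupConvexStepLaplace
import Summits.QuantumFields.BalabanUV.T4Continuum.Spine.NE7b.SupConvexClassTwoSidedAction

/-!
# THE VOLUME-FREE CEILINGS OF THE TORUS STEP: the torus form of `Δ^η + aQ′*Q′` has the CEILING `Σ φ·At φ ≤ (4d(n+1)² + a)·Σ φ²`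
# (summation by parts + `(p − q)² ≤ 2p² + 2q²` for the bonds, Cauchy–Schwarz per block for the block term), the block lift satisfies
# `Σ(M k)² = (n+1)^d·Σ k²` EXACTLY — so the torus action with `|u′| ≤ λ` is in the two-sided class with the VOLUME-FREE upper modulus
# `Λ = 4d(n+1)² + a + λ`, and the INTEGRATED block-spin step on the torus ((116)) carries the volume-free moduli
# `((min(2,a) − λ)(n+1)^d, (4d(n+1)² + a + λ)(n+1)^d)` — every period `s`; the blocking factor `n + 1` and `d` are the only parameters
# (row NE7b, node U5c; (89) + (96) + (116) + (117) + (118) BY NAME; [folklore])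

Cell `pub-balaban`, sub-cell `t4`, spine estimate NE7b (`T4WeightBudget.RelWeightBound`; the cell's OWN estimate — NOT PRINTED in
[Bałaban 1983–89], NOT PROVED).  Crux-route work under `Spine/NE7b/` by the row OWNER (`t4-ne7b-p1` gen 119) under FREEZE (0)'s
crux-prover clause (removing the volume dependence of (118)'s crude ceiling `|Site|·‖At‖` and of the crude lift ceiling `|Site|‖M‖²`);
NOTHING of Bałaban's is named as a Lean object, valued or asserted; no `T4Continuum/Support` leaf typed; no `def`, no notation; zero
`sorry`.  Imports (BY NAME): Mathlib's `sq_sum_le_card_mul_sum_sq`; the OWNER's (116) `…SupConvexStepIntegrated` (`integratedStep_closure`),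
(117) `…SupConvexStepLaplace` (`fibreMin_le_negLog_fibreIntegral`), (118) `…SupConvexClassTwoSidedAction` (`action_mem_twoSided`); through
them (89) `torus_operator_apply` ∕ `torus_lapForm_eq` ∕ `sum_mul_blockSum_eq` ∕ `sum_sq_eq_sum_blocks` ∕ `torus_form_coercive` ∕
`blockVolume_mul_sum_sq_blockAvg_le`, TDF `torus_operator_form_symm` ∕ `blockOf_siteOf_of_mem`, (96) `exists_clm_blockLift`, (110)
`step_closure`, (93) `sitewise_of_critical`, B6 `chart_mem_B`.

WHY (located).  The column's honest line is «constants mesh-∕volume-free ONLY as `(min(2,a) − λ)·Π vol`»; (118)∕(121) typed the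
two-sided membership and the integrated torus step with the crude, VOLUME-DEPENDENT ceilings `|Site|·‖At‖` and `|Site|‖M‖²`.  Both are
artefacts: by (89)'s summation by parts the Laplacian form is `(n+1)²Σ_μΣ_x(φ(x + ê_μ) − φ x)² ≤ 4d(n+1)²Σ φ²`, the block term is
`a(n+1)^{−d}Σ_y(Σ_block φ)² ≤ aΣ φ²` by Cauchy–Schwarz on each block of `(n+1)^d` sites, and the block lift repeats each coarse value
`(n+1)^d` times.  So the integrated step's moduli depend on the blocking factor and the dimension only — uniform in the period `s`.

WHAT IS PROVED ([folklore]; the `Beta.Site` carriers, every `d, n, s`):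
* §1 `sum_sq_shift` (`Σ_x φ(x + t)² = Σ_x φ x²` on the torus), **`torus_form_ceiling`** (`a ≥ 0`:
  `Σ_x φ x·(Rf(A(Ef φ))) x ≤ (4d(n+1)² + a)·Σ_x φ x²`).
* §2 **`lift_sum_sq_eq`** (the block lift `(M k) x = k(bt x)`: `Σ_x (M k x)² = (n+1)^d·Σ_y (k y)²`).
* §3 **`torus_action_mem_twoSided_uniform`** (`|u′| ≤ λ`, `a ≥ 0`: the torus action is in the two-sided class with
  `m = min(2,a) − λ` and the VOLUME-FREE `Λ = 4d(n+1)² + a + λ`).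
* §4 **`torus_integratedStep_uniform`** (THE END: `|u′| ≤ λ < min(2,a)`; ANY chart `P` of `ker Q′t` with `p·Σ z² ≤ Σ(P z)²`, `p > 0` ⟹
  `∃ M Φ W′` (block lift, torus background map, derivative family) with `HasFDerivAt W_int (W′ w) w` everywhere, the lower letter with
  modulus `(min(2,a) − λ)(n+1)^d`, the upper letter with modulus `(4d(n+1)² + a + λ)(n+1)^d`, and the Laplace bound
  `S(Φ w) − |σ|·log √(2π∕((min(2,a) − λ)p)) ≤ W_int(w)` — no constant depends on the period `s`).
* §5 toy.

HONEST (what this is NOT).  Elementary bounds; the ceiling `4d(n+1)² + a` is in COARSE lattice units (the factor `(n+1)²` is the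
fine Laplacian's norm — the blocking factor, a fixed number along the flow, not the volume); the chart `P` is quantified, not
constructed; no locality; `φ⁴` excluded (`|u′| ≤ λ`); cubic periods; scalar skeleton, hard constraint ((A3), NC-NE7b-α UNRULED); nothing
of Bałaban's.  BY-NAME EFFECT ON THE WALL: NONE.  NE7b NOT PRINTED ∕ NOT PROVED; spine PROVED 0∕9; rung (B)+1 on a FINITE torus — NOT
infinite volume, NOT the mass gap, NOT Clay.  HONEST DEPENDENCY: continuum YM on T⁴ ⇐ BetaPertH ∧ nine spine estimates (0∕9 proved);
BetaPertH ⇐ (D1) ∧ (D4) ∧ CAP+tail; G-an2-4 gates asym, D1 and NE2∕3∕4.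
-/

set_option autoImplicit false

noncomputable section

namespace Summit.QuantumFields.BalabanUV.T4Continuum.NE7b.SupTorusFormCeiling

open Set Function MeasureTheory Real
open scoped ENNReal
open Literature.MathematicalPhysics.QuantumFieldTheory.Balaban1983to89
open B6QGQLower276 (X e blk B side AX chart chart_mem_B)
open B5Hk103ScalarZd (nbhd)
open Beta (Site siteOf windowMap)
open SupTorusDirichletForm (torus_operator_form_symm blockOf_siteOf_of_mem)
open SupTorusDirichletFormCoercive (torus_operator_apply torus_lapForm_eq sum_mul_blockSum_eq sum_sq_eq_sum_blocks
  torus_form_coercive blockVolume_mul_sum_sq_blockAvg_le)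
open SupTorusActionMinimiser (sitewise_of_critical)
open SupTorusEffectiveActionGradient (exists_clm_blockLift)
open SupConvexStepSemigroup (step_closure)
open SupConvexStepIntegrated (integratedStep_closure)
open SupConvexStepLaplace (fibreMin_le_negLog_fibreIntegral)
open SupConvexClassTwoSidedAction (action_mem_twoSided)

variable {d : ℕ}

/-! ## §1. The volume-free ceiling of the torus form -/

section Ceiling

variable (n : ℕ) (a : ℝ) (s : ℕ) [NeZero s]
  {Aop : lp (fun _ : X d => ℝ) ∞ →L[ℝ] lp (fun _ : X d => ℝ) ∞}
  (hA : ∀ (f : lp (fun _ : X d => ℝ) ∞) (p : X d), Aop f p = ∑ r ∈ nbhd n p, AX n a p r * f r)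
  {Ef : (Site d ((n + 1) * s) → ℝ) →L[ℝ] lp (fun _ : X d => ℝ) ∞}
  (hEf : ∀ (g : Site d ((n + 1) * s) → ℝ) (q : X d), Ef g q = g (siteOf d ((n + 1) * s) q))
  {Rf : lp (fun _ : X d => ℝ) ∞ →L[ℝ] (Site d ((n + 1) * s) → ℝ)}
  (hRf : ∀ (h : lp (fun _ : X d => ℝ) ∞) (x : Site d ((n + 1) * s)), Rf h x = h (windowMap d ((n + 1) * s) x))

/-- A shifted sum of squares on the finite torus is the unshifted one. [folklore] -/
theorem sum_sq_shift (φ : Site d ((n + 1) * s) → ℝ) (t : Site d ((n + 1) * s)) :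
    ∑ x, φ (x + t) ^ 2 = ∑ x, φ x ^ 2 :=
  Fintype.sum_equiv (Equiv.addRight t) (fun x => φ (x + t) ^ 2) (fun x => φ x ^ 2) fun _ => rfl

include hA hEf hRf in
/-- **THE VOLUME-FREE CEILING OF THE TORUS FORM** (`a ≥ 0`): for every fine torus field,
`Σ_x φ x·(Rf (Aop (Ef φ))) x ≤ (4d(n+1)² + a)·Σ_x φ x²` — every `d`, blocking factor `n + 1`, period `s`. [folklore] -/
theorem torus_form_ceiling (ha : 0 ≤ a) (φ : Site d ((n + 1) * s) → ℝ) :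
    ∑ x, φ x * ((Rf.comp Aop).comp Ef) φ x ≤ (4 * d * ((n : ℝ) + 1) ^ 2 + a) * ∑ x, φ x ^ 2 := by
  classical
  have hsplit : ∑ x, φ x * ((Rf.comp Aop).comp Ef) φ x
      = ((n : ℝ) + 1) ^ 2 * ∑ μ : Fin d, ∑ x, (φ (x + siteOf d ((n + 1) * s) (e μ)) - φ x) ^ 2
        + a / ((n : ℝ) + 1) ^ d
          * ∑ y : Site d s, (∑ z : Fin d → Fin (n + 1), φ (siteOf d ((n + 1) * s) (chart n (windowMap d s y) z))) ^ 2 := by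
    simp only [ContinuousLinearMap.comp_apply, torus_operator_apply n a s hA hEf hRf]
    rw [← torus_lapForm_eq (fun μ => siteOf d ((n + 1) * s) (e μ)) φ, ← sum_mul_blockSum_eq n s φ, Finset.mul_sum,
      Finset.mul_sum, ← Finset.sum_add_distrib]
    exact Finset.sum_congr rfl fun x _ => by ring
  rw [hsplit]
  -- the bonds: `(p − q)² ≤ 2p² + 2q²` and translation invariance
  have hbond : ∀ μ : Fin d, ∑ x, (φ (x + siteOf d ((n + 1) * s) (e μ)) - φ x) ^ 2 ≤ 4 * ∑ x, φ x ^ 2 := fun μ => by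
    have hpt : ∀ x, (φ (x + siteOf d ((n + 1) * s) (e μ)) - φ x) ^ 2
        ≤ 2 * φ (x + siteOf d ((n + 1) * s) (e μ)) ^ 2 + 2 * φ x ^ 2 := fun x => by
      nlinarith [sq_nonneg (φ (x + siteOf d ((n + 1) * s) (e μ)) + φ x)]
    calc ∑ x, (φ (x + siteOf d ((n + 1) * s) (e μ)) - φ x) ^ 2
        ≤ ∑ x, (2 * φ (x + siteOf d ((n + 1) * s) (e μ)) ^ 2 + 2 * φ x ^ 2) := Finset.sum_le_sum fun x _ => hpt x
      _ = 4 * ∑ x, φ x ^ 2 := by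
          rw [Finset.sum_add_distrib, ← Finset.mul_sum, ← Finset.mul_sum, sum_sq_shift n s φ]; ring
  have hlap : ∑ μ : Fin d, ∑ x, (φ (x + siteOf d ((n + 1) * s) (e μ)) - φ x) ^ 2 ≤ d * (4 * ∑ x, φ x ^ 2) := by
    calc ∑ μ : Fin d, ∑ x, (φ (x + siteOf d ((n + 1) * s) (e μ)) - φ x) ^ 2 ≤ ∑ _μ : Fin d, 4 * ∑ x, φ x ^ 2 :=
          Finset.sum_le_sum fun μ _ => hbond μ
      _ = d * (4 * ∑ x, φ x ^ 2) := by rw [Finset.sum_const, Finset.card_univ, Fintype.card_fin, nsmul_eq_mul]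
  -- the blocks: Cauchy–Schwarz on the `(n+1)^d` sites of each block
  have hcard : (Fintype.card (Fin d → Fin (n + 1)) : ℝ) = ((n : ℝ) + 1) ^ d := by simp
  have hblock : ∑ y : Site d s, (∑ z : Fin d → Fin (n + 1), φ (siteOf d ((n + 1) * s) (chart n (windowMap d s y) z))) ^ 2
      ≤ ((n : ℝ) + 1) ^ d * ∑ x, φ x ^ 2 := by
    rw [sum_sq_eq_sum_blocks n s φ, Finset.mul_sum]
    refine Finset.sum_le_sum fun y _ => ?_
    have h := sq_sum_le_card_mul_sum_sq (s := (Finset.univ : Finset (Fin d → Fin (n + 1))))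
      (f := fun z => φ (siteOf d ((n + 1) * s) (chart n (windowMap d s y) z)))
    rw [Finset.card_univ, hcard] at h
    exact h
  have hvol : (0 : ℝ) < ((n : ℝ) + 1) ^ d := by positivity
  have hb2 : a / ((n : ℝ) + 1) ^ d
      * ∑ y : Site d s, (∑ z : Fin d → Fin (n + 1), φ (siteOf d ((n + 1) * s) (chart n (windowMap d s y) z))) ^ 2
      ≤ a * ∑ x, φ x ^ 2 := by
    calc a / ((n : ℝ) + 1) ^ d
          * ∑ y : Site d s, (∑ z : Fin d → Fin (n + 1), φ (siteOf d ((n + 1) * s) (chart n (windowMap d s y) z))) ^ 2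
        ≤ a / ((n : ℝ) + 1) ^ d * (((n : ℝ) + 1) ^ d * ∑ x, φ x ^ 2) :=
          mul_le_mul_of_nonneg_left hblock (div_nonneg ha hvol.le)
      _ = a * ∑ x, φ x ^ 2 := by field_simp
  have hn2 : (0 : ℝ) ≤ ((n : ℝ) + 1) ^ 2 := by positivity
  have hb1 := mul_le_mul_of_nonneg_left hlap hn2
  calc ((n : ℝ) + 1) ^ 2 * ∑ μ : Fin d, ∑ x, (φ (x + siteOf d ((n + 1) * s) (e μ)) - φ x) ^ 2
        + a / ((n : ℝ) + 1) ^ d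
          * ∑ y : Site d s, (∑ z : Fin d → Fin (n + 1), φ (siteOf d ((n + 1) * s) (chart n (windowMap d s y) z))) ^ 2
      ≤ ((n : ℝ) + 1) ^ 2 * (d * (4 * ∑ x, φ x ^ 2)) + a * ∑ x, φ x ^ 2 := add_le_add hb1 hb2
    _ = (4 * d * ((n : ℝ) + 1) ^ 2 + a) * ∑ x, φ x ^ 2 := by ring

end Ceiling

/-! ## §2. The exact block-lift identity -/

section Lift

variable (n s : ℕ) [NeZero s]

/-- **THE BLOCK LIFT REPEATS EACH COARSE VALUE `(n+1)^d` TIMES**: if `(M k) x = k(bt x)` (`bt = siteOf ∘ blk ∘ windowMap`) then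
`Σ_x (M k x)² = (n+1)^d·Σ_y (k y)²`. [folklore] -/
theorem lift_sum_sq_eq (M : (Site d s → ℝ) →L[ℝ] (Site d ((n + 1) * s) → ℝ))
    (hM : ∀ (k : Site d s → ℝ) (x : Site d ((n + 1) * s)), M k x = k (siteOf d s (blk n (windowMap d ((n + 1) * s) x))))
    (k : Site d s → ℝ) : ∑ x, M k x ^ 2 = ((n : ℝ) + 1) ^ d * ∑ y, k y ^ 2 := by
  classical
  have hcard : (Fintype.card (Fin d → Fin (n + 1)) : ℝ) = ((n : ℝ) + 1) ^ d := by simp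
  rw [sum_sq_eq_sum_blocks n s (M k), Finset.mul_sum]
  refine Finset.sum_congr rfl fun y _ => ?_
  have hconst : ∀ z : Fin d → Fin (n + 1), M k (siteOf d ((n + 1) * s) (chart n (windowMap d s y) z)) = k y := fun z => by
    rw [hM, blockOf_siteOf_of_mem n s (chart_mem_B n (windowMap d s y) z)]
  simp only [hconst, Finset.sum_const, Finset.card_univ, nsmul_eq_mul, hcard]

end Lift

/-! ## §3. The torus action in the two-sided class with volume-free moduli -/

section TwoSided

variable (n : ℕ) (a : ℝ) (s : ℕ) [NeZero s]
  {Aop : lp (fun _ : X d => ℝ) ∞ →L[ℝ] lp (fun _ : X d => ℝ) ∞}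
  (hA : ∀ (f : lp (fun _ : X d => ℝ) ∞) (p : X d), Aop f p = ∑ r ∈ nbhd n p, AX n a p r * f r)
  {v u u' : ℝ → ℝ} (hv : ∀ t, HasDerivAt v (u t) t) (hu : ∀ t, HasDerivAt u (u' t) t)
  {lam : ℝ} (hlam : ∀ t, |u' t| ≤ lam)
  {Ef : (Site d ((n + 1) * s) → ℝ) →L[ℝ] lp (fun _ : X d => ℝ) ∞}
  (hEf : ∀ (g : Site d ((n + 1) * s) → ℝ) (q : X d), Ef g q = g (siteOf d ((n + 1) * s) q))
  {Rf : lp (fun _ : X d => ℝ) ∞ →L[ℝ] (Site d ((n + 1) * s) → ℝ)}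
  (hRf : ∀ (h : lp (fun _ : X d => ℝ) ∞) (x : Site d ((n + 1) * s)), Rf h x = h (windowMap d ((n + 1) * s) x))

include hA hv hu hlam hEf hRf in
/-- **THE TORUS ACTION IS IN THE TWO-SIDED CLASS WITH VOLUME-FREE MODULI**: `|u′| ≤ λ`, `a ≥ 0` ⟹ with `S′ = fderiv S`:
`HasFDerivAt` everywhere, the lower letter with `m = min(2,a) − λ` and the upper letter with `Λ = 4d(n+1)² + a + λ`. [folklore] -/
theorem torus_action_mem_twoSided_uniform (ha : 0 ≤ a) :
    (∀ φ : Site d ((n + 1) * s) → ℝ,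
      HasFDerivAt (fun φ : Site d ((n + 1) * s) → ℝ => (1 / 2 : ℝ) * ∑ x, φ x * ((Rf.comp Aop).comp Ef) φ x + ∑ x, v (φ x))
        (fderiv ℝ (fun φ : Site d ((n + 1) * s) → ℝ =>
          (1 / 2 : ℝ) * ∑ x, φ x * ((Rf.comp Aop).comp Ef) φ x + ∑ x, v (φ x)) φ) φ) ∧
    (∀ φ ψ : Site d ((n + 1) * s) → ℝ,
      ((1 / 2 : ℝ) * ∑ x, φ x * ((Rf.comp Aop).comp Ef) φ x + ∑ x, v (φ x))
        + fderiv ℝ (fun φ : Site d ((n + 1) * s) → ℝ =>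
            (1 / 2 : ℝ) * ∑ x, φ x * ((Rf.comp Aop).comp Ef) φ x + ∑ x, v (φ x)) φ (ψ - φ)
        + (min 2 a - lam) / 2 * ∑ x, (ψ x - φ x) ^ 2
      ≤ (1 / 2 : ℝ) * ∑ x, ψ x * ((Rf.comp Aop).comp Ef) ψ x + ∑ x, v (ψ x)) ∧
    ∀ φ ψ : Site d ((n + 1) * s) → ℝ,
      (1 / 2 : ℝ) * ∑ x, ψ x * ((Rf.comp Aop).comp Ef) ψ x + ∑ x, v (ψ x) ≤
      ((1 / 2 : ℝ) * ∑ x, φ x * ((Rf.comp Aop).comp Ef) φ x + ∑ x, v (φ x))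
        + fderiv ℝ (fun φ : Site d ((n + 1) * s) → ℝ =>
            (1 / 2 : ℝ) * ∑ x, φ x * ((Rf.comp Aop).comp Ef) φ x + ∑ x, v (φ x)) φ (ψ - φ)
        + (4 * d * ((n : ℝ) + 1) ^ 2 + a + lam) / 2 * ∑ x, (ψ x - φ x) ^ 2 :=
  action_mem_twoSided ((Rf.comp Aop).comp Ef) (torus_operator_form_symm n a s hA hEf hRf) (torus_form_coercive n a s hA hEf hRf)
    (torus_form_ceiling n a s hA hEf hRf ha) hv hu (fun t => (abs_le.1 (hlam t)).1) (fun t => (abs_le.1 (hlam t)).2)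

end TwoSided

/-! ## §4. The integrated step on the torus with volume-free moduli -/

section Torus

variable (n : ℕ) (a : ℝ) (s : ℕ) [NeZero s]
  {Dop Aop : lp (fun _ : X d => ℝ) ∞ →L[ℝ] lp (fun _ : X d => ℝ) ∞}
  (hD : ∀ (f : lp (fun _ : X d => ℝ) ∞) (y : X d), Dop f y = (((n : ℝ) + 1) ^ d)⁻¹ * ∑ p ∈ B n y, f p)
  (hA : ∀ (f : lp (fun _ : X d => ℝ) ∞) (p : X d), Aop f p = ∑ r ∈ nbhd n p, AX n a p r * f r)
  {v u u' : ℝ → ℝ} (hv : ∀ t, HasDerivAt v (u t) t) (hu : ∀ t, HasDerivAt u (u' t) t)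
  {lam : ℝ} (hlam : ∀ t, |u' t| ≤ lam) (hγ : lam < min 2 a)
  {Ef : (Site d ((n + 1) * s) → ℝ) →L[ℝ] lp (fun _ : X d => ℝ) ∞}
  (hEf : ∀ (g : Site d ((n + 1) * s) → ℝ) (q : X d), Ef g q = g (siteOf d ((n + 1) * s) q))
  {Rf : lp (fun _ : X d => ℝ) ∞ →L[ℝ] (Site d ((n + 1) * s) → ℝ)}
  (hRf : ∀ (h : lp (fun _ : X d => ℝ) ∞) (x : Site d ((n + 1) * s)), Rf h x = h (windowMap d ((n + 1) * s) x))
  {Rc : lp (fun _ : X d => ℝ) ∞ →L[ℝ] (Site d s → ℝ)}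
  (hRc : ∀ (h : lp (fun _ : X d => ℝ) ∞) (x : Site d s), Rc h x = h (windowMap d s x))

include hD hA hv hu hlam hγ hEf hRf hRc in
/-- **THE END: THE INTEGRATED BLOCK-SPIN STEP ON THE TORUS WITH VOLUME-FREE MODULI.**  `v′ = u`, `|u′| ≤ λ`, `λ < min(2,a)`; `σ` ANY
finite type, `P` ANY continuous linear chart of the zero-mean fields (`Q′t∘P = 0`) with `p·Σ z² ≤ Σ(P z)²`, `p > 0`.  Then there are the
block lift `M`, the torus background map `Φ` (block means + sitewise equation) and a derivative family `W′` of
`W_int(w) = −log ∫ e^{−S(M w + P z)} dz` with, at every coarse field: `HasFDerivAt W_int (W′ w) w`; the lower letter with modulus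
`(min(2,a) − λ)(n+1)^d`; the upper letter with modulus `(4d(n+1)² + a + λ)(n+1)^d`; the Laplace bound
`S(Φ w) − |σ|·log √(2π∕((min(2,a) − λ)p)) ≤ W_int(w)` — NO constant depends on the period `s`. [folklore] -/
theorem torus_integratedStep_uniform {σ : Type*} [Fintype σ] (P : (σ → ℝ) →L[ℝ] (Site d ((n + 1) * s) → ℝ))
    (hQP : ∀ z : σ → ℝ, ((Rc.comp Dop).comp Ef) (P z) = 0) {p : ℝ}
    (hP : ∀ z : σ → ℝ, p * ∑ i, z i ^ 2 ≤ ∑ x, P z x ^ 2) (hp : 0 < p) :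
    ∃ (M : (Site d s → ℝ) →L[ℝ] (Site d ((n + 1) * s) → ℝ)) (Φ : (Site d s → ℝ) → (Site d ((n + 1) * s) → ℝ))
      (W' : (Site d s → ℝ) → (Site d s → ℝ) →L[ℝ] ℝ),
      (∀ k, ((Rc.comp Dop).comp Ef) (M k) = k) ∧
      (∀ w, ((Rc.comp Dop).comp Ef) (Φ w) = w) ∧
      (∀ (w : Site d s → ℝ) (q : X d), Aop (Ef (Φ w)) q + u (Ef (Φ w) q)
        = (((n : ℝ) + 1) ^ d)⁻¹ * ∑ q' ∈ B n (blk n q), (Aop (Ef (Φ w)) q' + u (Ef (Φ w) q'))) ∧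
      (∀ w, HasFDerivAt (fun w : Site d s → ℝ => -log (∫ z : σ → ℝ,
          exp (-((1 / 2 : ℝ) * ∑ x, (M w + P z) x * ((Rf.comp Aop).comp Ef) (M w + P z) x + ∑ x, v ((M w + P z) x)))))
        (W' w) w) ∧
      (∀ w w' : Site d s → ℝ,
        -log (∫ z : σ → ℝ,
            exp (-((1 / 2 : ℝ) * ∑ x, (M w + P z) x * ((Rf.comp Aop).comp Ef) (M w + P z) x + ∑ x, v ((M w + P z) x))))
          + W' w (w' - w) + (min 2 a - lam) * ((n : ℝ) + 1) ^ d / 2 * ∑ y, (w' y - w y) ^ 2 ≤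
        -log (∫ z : σ → ℝ,
            exp (-((1 / 2 : ℝ) * ∑ x, (M w' + P z) x * ((Rf.comp Aop).comp Ef) (M w' + P z) x + ∑ x, v ((M w' + P z) x))))) ∧
      (∀ w w' : Site d s → ℝ,
        -log (∫ z : σ → ℝ,
            exp (-((1 / 2 : ℝ) * ∑ x, (M w' + P z) x * ((Rf.comp Aop).comp Ef) (M w' + P z) x + ∑ x, v ((M w' + P z) x))))
          ≤ -log (∫ z : σ → ℝ,
            exp (-((1 / 2 : ℝ) * ∑ x, (M w + P z) x * ((Rf.comp Aop).comp Ef) (M w + P z) x + ∑ x, v ((M w + P z) x))))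
          + W' w (w' - w)
          + (4 * d * ((n : ℝ) + 1) ^ 2 + a + lam) * ((n : ℝ) + 1) ^ d / 2 * ∑ y, (w' y - w y) ^ 2) ∧
      ∀ w : Site d s → ℝ,
        ((1 / 2 : ℝ) * ∑ x, Φ w x * ((Rf.comp Aop).comp Ef) (Φ w) x + ∑ x, v (Φ w x))
          - Fintype.card σ * log (√(2 * π / ((min 2 a - lam) * p))) ≤
        -log (∫ z : σ → ℝ,
            exp (-((1 / 2 : ℝ) * ∑ x, (M w + P z) x * ((Rf.comp Aop).comp Ef) (M w + P z) x + ∑ x, v ((M w + P z) x)))) := by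
  have hm : 0 < min 2 a - lam := sub_pos.2 hγ
  have hlam0 : 0 ≤ lam := (abs_nonneg _).trans (hlam 0)
  have ha : 0 ≤ a := by
    have : lam < a := hγ.trans_le (min_le_right _ _)
    linarith
  obtain ⟨M, hMapply, hM⟩ := exists_clm_blockLift n s hD hEf hRc
  obtain ⟨hS, hlo, hup⟩ := torus_action_mem_twoSided_uniform n a s hA hv hu hlam hEf hRf ha
  have hΛ : 0 ≤ 4 * d * ((n : ℝ) + 1) ^ 2 + a + lam := by positivity
  have hJ : ∀ h : Site d ((n + 1) * s) → ℝ,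
      ((n : ℝ) + 1) ^ d * ∑ y, ((Rc.comp Dop).comp Ef) h y ^ 2 ≤ ∑ x, h x ^ 2 := fun h => by
    simpa only [ContinuousLinearMap.comp_apply] using blockVolume_mul_sum_sq_blockAvg_le n s hD hEf hRc h
  have hμ : ∀ k : Site d s → ℝ, ∑ x, M k x ^ 2 ≤ ((n : ℝ) + 1) ^ d * ∑ y, k y ^ 2 :=
    fun k => (lift_sum_sq_eq n s M hMapply k).le
  obtain ⟨Φ, hΦQ, hΦcrit, hΦmin, -, -, -⟩ := step_closure hS hlo hm ((Rc.comp Dop).comp Ef) M hM hJ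
  obtain ⟨W', hW', hWlo, hWup⟩ :=
    integratedStep_closure ((Rc.comp Dop).comp Ef) M P hS hlo hm hup hΛ hM hμ hJ hQP hP hp
  refine ⟨M, Φ, W', hM, hΦQ, fun w q => sitewise_of_critical n a s hD hA hEf hRf hRc hv (Φ w) (hΦcrit w) q, hW',
    fun w w' => ?_, fun w w' => ?_, fun w => ?_⟩
  · have h := hWlo w w'
    simpa only [mul_div_assoc, mul_assoc] using h
  · have h := hWup w w'
    simpa only [mul_div_assoc, mul_assoc] using h
  · exact fibreMin_le_negLog_fibreIntegral ((Rc.comp Dop).comp Ef) M P hS hlo hm hM hQP hP hp hΦmin w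

end Torus

/-! ## §5. Toy -/

/-- Toy (§1 `sum_sq_shift` on the one-dimensional torus of period `(0+1)·1`). -/
example (φ : Site 1 ((0 + 1) * 1) → ℝ) (t : Site 1 ((0 + 1) * 1)) : ∑ x, φ (x + t) ^ 2 = ∑ x, φ x ^ 2 :=
  sum_sq_shift 0 1 φ t

end Summit.QuantumFields.BalabanUV.T4Continuum.NE7b.SupTorusFormCeiling

end
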